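import Summits.Ventures.HodgeRepro2.T5SU11ResolventTransform

/-!
# The spherical transform diagonalises the resolvent: `(λ′(λ′−2) − λ(λ−2)) ∫_0^∞ (G_λ f) φ_{λ′} sinh 2t = ∫_0^∞ f φ_{λ′} sinh 2t`

For `1 < λ′ < λ` and a continuous source `f` supported in `[a, b] ⊂ (0, ∞)`, Green's identity (row 467) for
`u = G_λ f` (rows 451–452) and `v = φ_{λ′}(a_·)` on `[ε, R]`, `0 < ε ≤ a`, `b ≤ R`, reads
`∫_a^b f v sinh 2t = W(R) − W(ε) + (μ′ − μ) ∫_ε^R u v sinh 2t` (`green_identity_resolvent`; the source integral is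
over `[a, b]` because `f` vanishes outside). Row 469 gives `W(ε) → 0`, `W(R) → 0` and the integrability of
`u v sinh 2t` on `(0, ∞)`; letting `ε → 0⁺` (`resolvent_transform_finite`) and then `R → ∞`:

  **`(λ′(λ′−2) − λ(λ−2)) · ∫_{(0,∞)} (G_λ f)(t) φ_{λ′}(a_t) sinh 2t dt = ∫_a^b f(t) φ_{λ′}(a_t) sinh 2t dt`**
  (`resolvent_transform`),

i.e. since `μ − μ′ = (λ − λ′)(λ + λ′ − 2) > 0` (`mu_sub_mu_pos`) and `∫_{(0,∞)} f φ_{λ′} sinh 2t = ∫_a^b f φ_{λ′}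
sinh 2t` (`integral_Ioi_eq_intervalIntegral`):

  **`∫_{(0,∞)} (G_λ f) φ_{λ′} sinh 2t = (∫_{(0,∞)} f φ_{λ′} sinh 2t) / (λ′(λ′−2) − λ(λ−2))`**
  (`sphTransform_sphGreen`)

— in the Cartan form of the spherical transform (`f̂(λ′) = π ∫_0^∞ f(a_t) φ_{λ′}(a_t) sinh 2t dt`, row 25x) the
resolvent `(L − λ(λ−2))⁻¹` of the radial Laplacian acts as multiplication by `1/(λ′(λ′−2) − λ(λ−2))`: the spherical
transform diagonalises it. Nothing is claimed about (N).

Blind lane: Mathlib + the HodgeRepro2 prefix only; no sorry; axioms ⊆ {propext, Classical.choice,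
Quot.sound}.
-/

namespace Summit.Ventures.HodgeRepro2.T5SU11ResolventDiagonal

open Filter Topology MeasureTheory intervalIntegral
open Set (Ioi Ioc Icc uIcc)
open T5SU11Cartan T5SU11SphericalFunction T5SU11SphericalBounds T5SU11SphericalContinuous
  T5SU11ReductionOfOrder T5SU11ReductionOfOrderInfinity T5SU11SphericalSolutionSpaceAll T5SU11SphericalDecay
  T5SU11RadialGreen T5SU11SphericalGreen T5SU11GreenIdentityInhomogeneous T5SU11ResolventBoundary
  T5SU11ResolventTransform

section measure

variable [MeasurableSpace Circle] [BorelSpace Circle]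

variable {lam lam' a b : ℝ} {f : ℝ → ℝ} (h1 : 1 < lam') (h2 : lam' < lam) (hf : ContinuousOn f (Ioi 0))
  (ha : 0 < a) (hab : a ≤ b) (hfa : ∀ s, s ≤ a → f s = 0) (hfb : ∀ s, b ≤ s → f s = 0)

/-! ### `∫_0^ε u v sinh 2t → 0` -/

/-- The primitive `ε ↦ ∫_0^ε sinh 2t φ_λ φ_{λ′}` tends to `0` as `ε → 0⁺`. -/
theorem tendsto_integral_sph_mul_nhdsGT_zero :
    Tendsto (fun ε => ∫ t in (0 : ℝ)..ε, Real.sinh (2 * t) * sph lam (hyp t) * sph lam' (hyp t))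
      (𝓝[>] 0) (𝓝 0) := by
  have hcont := continuous_integrand lam lam'
  have hprim : Tendsto (fun ε => ∫ t in (0 : ℝ)..ε, Real.sinh (2 * t) * sph lam (hyp t) * sph lam' (hyp t))
      (𝓝 0) (𝓝 (∫ t in (0 : ℝ)..(0 : ℝ), Real.sinh (2 * t) * sph lam (hyp t) * sph lam' (hyp t))) := by
    have hd := integral_hasDerivAt_right (hcont.intervalIntegrable 0 0)
      (hcont.stronglyMeasurableAtFilter _ _) hcont.continuousAt
    exact hd.continuousAt.tendsto
  rw [integral_same] at hprim
  exact hprim.mono_left (nhdsWithin_le_nhds (s := Ioi 0))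

include h1 h2 hf ha hab hfa in
/-- `∫_0^ε u v sinh 2t = −c₁ ∫_0^ε sinh 2t φ_λ φ_{λ′}` for `0 < ε ≤ a`. -/
theorem integral_green_mul_sph_of_le {ε : ℝ} (hε : 0 < ε) (hεa : ε ≤ a) :
    ∫ t in (0 : ℝ)..ε, sphGreen lam f a b t * sph lam' (hyp t) * Real.sinh (2 * t)
      = -(∫ s in a..b, sphDecay lam s * f s * Real.sinh (2 * s))
        * ∫ t in (0 : ℝ)..ε, Real.sinh (2 * t) * sph lam (hyp t) * sph lam' (hyp t) := by
  rw [← intervalIntegral.integral_const_mul]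
  refine integral_congr_ae (Filter.Eventually.of_forall fun t ht => ?_)
  rw [Set.uIoc_of_le hε.le] at ht
  rw [(sphGreen_of_le h1 h2 hf ha hab hfa ht.1 (le_trans ht.2 hεa)).1]
  ring

include h1 h2 hf ha hab hfa in
/-- **`∫_0^ε u v sinh 2t → 0`** as `ε → 0⁺`. -/
theorem tendsto_integral_green_mul_sph_nhdsGT_zero :
    Tendsto (fun ε => ∫ t in (0 : ℝ)..ε, sphGreen lam f a b t * sph lam' (hyp t) * Real.sinh (2 * t)) (𝓝[>] 0) (𝓝 0) := by
  have h := (tendsto_integral_sph_mul_nhdsGT_zero (lam := lam) (lam' := lam')).const_mul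
    (-(∫ s in a..b, sphDecay lam s * f s * Real.sinh (2 * s)))
  rw [mul_zero] at h
  refine h.congr' ?_
  filter_upwards [Ioo_mem_nhdsGT ha] with ε hε
  exact (integral_green_mul_sph_of_le h1 h2 hf ha hab hfa hε.1 hε.2.le).symm

/-! ### Green's identity for `u = G_λ f`, `v = φ_{λ′}` -/

include h1 h2 hf ha hab hfa hfb in
/-- **Green's identity on `[ε, R]`**, `0 < ε ≤ a`, `b ≤ R`: `∫_a^b f v sinh 2t = W(R) − W(ε) + (μ′ − μ) ∫_ε^R u v
sinh 2t` (the source integral is over `[a, b]` because `f` vanishes outside `[a, b]`). -/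
theorem green_identity_resolvent {ε R : ℝ} (hε : 0 < ε) (hεa : ε ≤ a) (hbR : b ≤ R) :
    ∫ t in a..b, f t * sph lam' (hyp t) * Real.sinh (2 * t)
      = (Real.sinh (2 * R) * (sph lam' (hyp R) * sphGreen' lam f a b R
            - sphGreen lam f a b R * deriv (fun t => sph lam' (hyp t)) R)
          - Real.sinh (2 * ε) * (sph lam' (hyp ε) * sphGreen' lam f a b ε
            - sphGreen lam f a b ε * deriv (fun t => sph lam' (hyp t)) ε))
        + (lam' * (lam' - 2) - lam * (lam - 2)) * ∫ t in ε..R, sphGreen lam f a b t * sph lam' (hyp t) * Real.sinh (2 * t) := by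
  have hlam := lt_trans h1 h2
  have hb : 0 < b := lt_of_lt_of_le ha hab
  have hR : 0 < R := lt_of_lt_of_le hb hbR
  have hεR : ε ≤ R := le_trans hεa (le_trans hab hbR)
  have h := green_identity_inhom (μ := lam * (lam - 2)) (μ' := lam' * (lam' - 2))
    (u := sphGreen lam f a b) (u' := sphGreen' lam f a b) (u'' := sphGreen'' lam f a b)
    (v := fun t => sph lam' (hyp t)) (v' := deriv (fun t => sph lam' (hyp t)))
    (v'' := deriv (deriv (fun t => sph lam' (hyp t))))
    (fun t ht => hasDerivAt_sphGreen hlam hf ha hab ht) (fun t ht => hasDerivAt_sphGreen' hlam hf ha hab ht)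
    (fun t ht => sphGreen_ode hlam ht) (hφ_sph lam') (hφ'_sph lam') (hode_sph lam') hf hε hεR
  rw [← h]
  have hcont : ContinuousOn (fun t => f t * sph lam' (hyp t) * Real.sinh (2 * t)) (Ioi 0) :=
    (hf.mul (continuous_sph_hyp lam').continuousOn).mul
      (Real.continuous_sinh.comp (continuous_const.mul continuous_id)).continuousOn
  have hi1 : IntervalIntegrable (fun t => f t * sph lam' (hyp t) * Real.sinh (2 * t)) volume ε a :=
    (hcont.mono (uIcc_subset_Ioi hε ha)).intervalIntegrable
  have hi2 : IntervalIntegrable (fun t => f t * sph lam' (hyp t) * Real.sinh (2 * t)) volume a b :=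
    (hcont.mono (uIcc_subset_Ioi ha hb)).intervalIntegrable
  have hi3 : IntervalIntegrable (fun t => f t * sph lam' (hyp t) * Real.sinh (2 * t)) volume b R :=
    (hcont.mono (uIcc_subset_Ioi hb hR)).intervalIntegrable
  have hz1 : ∫ t in ε..a, f t * sph lam' (hyp t) * Real.sinh (2 * t) = 0 := by
    refine (integral_congr (g := fun _ => (0 : ℝ)) fun t ht => ?_).trans integral_zero
    rw [Set.uIcc_of_le hεa] at ht
    simp only [hfa t ht.2, zero_mul]
  have hz3 : ∫ t in b..R, f t * sph lam' (hyp t) * Real.sinh (2 * t) = 0 := by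
    refine (integral_congr (g := fun _ => (0 : ℝ)) fun t ht => ?_).trans integral_zero
    rw [Set.uIcc_of_le hbR] at ht
    simp only [hfb t ht.1, zero_mul]
  rw [← integral_add_adjacent_intervals hi1 (hi2.trans hi3), ← integral_add_adjacent_intervals hi2 hi3,
    hz1, hz3, zero_add, add_zero]

/-! ### The passage to the limit -/

include h1 h2 hf ha hab hfa hfb in
/-- **Step A (`ε → 0⁺`)**: for `R ≥ b`, `∫_a^b f φ_{λ′} sinh 2t = W(R) + (μ′ − μ) ∫_0^R G_λ f · φ_{λ′} sinh 2t`. -/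
theorem resolvent_transform_finite {R : ℝ} (hbR : b ≤ R) :
    ∫ t in a..b, f t * sph lam' (hyp t) * Real.sinh (2 * t)
      = Real.sinh (2 * R) * (sph lam' (hyp R) * sphGreen' lam f a b R
            - sphGreen lam f a b R * deriv (fun t => sph lam' (hyp t)) R)
        + (lam' * (lam' - 2) - lam * (lam - 2)) * ∫ t in (0 : ℝ)..R, sphGreen lam f a b t * sph lam' (hyp t) * Real.sinh (2 * t) := by
  have hb : 0 < b := lt_of_lt_of_le ha hab
  have hR : 0 < R := lt_of_lt_of_le hb hbR
  have hgint : ∀ c, 0 ≤ c →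
      IntervalIntegrable (fun t => sphGreen lam f a b t * sph lam' (hyp t) * Real.sinh (2 * t)) volume 0 c := fun c hc =>
    (intervalIntegrable_iff_integrableOn_Ioc_of_le hc).mpr
      ((integrableOn_green_mul_sph h1 h2 hf ha hab hfa hfb).mono_set Set.Ioc_subset_Ioi_self)
  -- the identity is constant in `ε ∈ (0, a]`
  have hconst : Tendsto (fun ε => (Real.sinh (2 * R) * (sph lam' (hyp R) * sphGreen' lam f a b R
            - sphGreen lam f a b R * deriv (fun t => sph lam' (hyp t)) R)
          - Real.sinh (2 * ε) * (sph lam' (hyp ε) * sphGreen' lam f a b ε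
            - sphGreen lam f a b ε * deriv (fun t => sph lam' (hyp t)) ε))
        + (lam' * (lam' - 2) - lam * (lam - 2)) * ∫ t in ε..R, sphGreen lam f a b t * sph lam' (hyp t) * Real.sinh (2 * t))
      (𝓝[>] 0) (𝓝 (∫ t in a..b, f t * sph lam' (hyp t) * Real.sinh (2 * t))) := by
    refine tendsto_const_nhds.congr' ?_
    filter_upwards [Ioo_mem_nhdsGT ha] with ε hε
    exact green_identity_resolvent h1 h2 hf ha hab hfa hfb hε.1 hε.2.le hbR
  -- and tends to the limit
  have hlim : Tendsto (fun ε => (Real.sinh (2 * R) * (sph lam' (hyp R) * sphGreen' lam f a b R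
            - sphGreen lam f a b R * deriv (fun t => sph lam' (hyp t)) R)
          - Real.sinh (2 * ε) * (sph lam' (hyp ε) * sphGreen' lam f a b ε
            - sphGreen lam f a b ε * deriv (fun t => sph lam' (hyp t)) ε))
        + (lam' * (lam' - 2) - lam * (lam - 2)) * ∫ t in ε..R, sphGreen lam f a b t * sph lam' (hyp t) * Real.sinh (2 * t))
      (𝓝[>] 0) (𝓝 ((Real.sinh (2 * R) * (sph lam' (hyp R) * sphGreen' lam f a b R
            - sphGreen lam f a b R * deriv (fun t => sph lam' (hyp t)) R) - 0)
        + (lam' * (lam' - 2) - lam * (lam - 2)) * ((∫ t in (0 : ℝ)..R, sphGreen lam f a b t * sph lam' (hyp t) * Real.sinh (2 * t)) - 0))) := by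
    have hW : Tendsto (fun ε => Real.sinh (2 * R) * (sph lam' (hyp R) * sphGreen' lam f a b R
            - sphGreen lam f a b R * deriv (fun t => sph lam' (hyp t)) R)
          - Real.sinh (2 * ε) * (sph lam' (hyp ε) * sphGreen' lam f a b ε
            - sphGreen lam f a b ε * deriv (fun t => sph lam' (hyp t)) ε)) (𝓝[>] 0) (𝓝 (Real.sinh (2 * R) * (sph lam' (hyp R) * sphGreen' lam f a b R
            - sphGreen lam f a b R * deriv (fun t => sph lam' (hyp t)) R) - 0)) :=
      tendsto_const_nhds.sub (tendsto_green_bracket_left h1 h2 hf ha hab hfa)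
    have hg : Tendsto (fun ε => (∫ t in (0 : ℝ)..R, sphGreen lam f a b t * sph lam' (hyp t) * Real.sinh (2 * t))
          - ∫ t in (0 : ℝ)..ε, sphGreen lam f a b t * sph lam' (hyp t) * Real.sinh (2 * t)) (𝓝[>] 0)
        (𝓝 ((∫ t in (0 : ℝ)..R, sphGreen lam f a b t * sph lam' (hyp t) * Real.sinh (2 * t)) - 0)) :=
      tendsto_const_nhds.sub (tendsto_integral_green_mul_sph_nhdsGT_zero h1 h2 hf ha hab hfa)
    refine (hW.add (hg.const_mul (lam' * (lam' - 2) - lam * (lam - 2)))).congr' ?_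
    filter_upwards [Ioo_mem_nhdsGT ha] with ε hε
    rw [integral_interval_sub_left (hgint R hR.le) (hgint ε hε.1.le)]
  rw [tendsto_nhds_unique hconst hlim, sub_zero, sub_zero]

include h1 h2 hf ha hab hfa hfb in
/-- **The spherical transform diagonalises the resolvent**: for `1 < λ′ < λ` and `f` supported in `[a, b]`,
`(λ′(λ′ − 2) − λ(λ − 2)) ∫_0^∞ G_λ f · φ_{λ′} sinh 2t = ∫_a^b f φ_{λ′} sinh 2t`. -/
theorem resolvent_transform :
    (lam' * (lam' - 2) - lam * (lam - 2)) * ∫ t in Ioi 0, sphGreen lam f a b t * sph lam' (hyp t) * Real.sinh (2 * t)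
      = ∫ t in a..b, f t * sph lam' (hyp t) * Real.sinh (2 * t) := by
  have hint := integrableOn_green_mul_sph h1 h2 hf ha hab hfa hfb
  have hconst : Tendsto (fun R => Real.sinh (2 * R) * (sph lam' (hyp R) * sphGreen' lam f a b R
            - sphGreen lam f a b R * deriv (fun t => sph lam' (hyp t)) R)
        + (lam' * (lam' - 2) - lam * (lam - 2)) * ∫ t in (0 : ℝ)..R, sphGreen lam f a b t * sph lam' (hyp t) * Real.sinh (2 * t))
      atTop (𝓝 (∫ t in a..b, f t * sph lam' (hyp t) * Real.sinh (2 * t))) := by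
    refine tendsto_const_nhds.congr' ?_
    filter_upwards [eventually_ge_atTop b] with R hR
    exact resolvent_transform_finite h1 h2 hf ha hab hfa hfb hR
  have hlim : Tendsto (fun R => Real.sinh (2 * R) * (sph lam' (hyp R) * sphGreen' lam f a b R
            - sphGreen lam f a b R * deriv (fun t => sph lam' (hyp t)) R)
        + (lam' * (lam' - 2) - lam * (lam - 2)) * ∫ t in (0 : ℝ)..R, sphGreen lam f a b t * sph lam' (hyp t) * Real.sinh (2 * t))
      atTop (𝓝 (0 + (lam' * (lam' - 2) - lam * (lam - 2)) * ∫ t in Ioi 0, sphGreen lam f a b t * sph lam' (hyp t) * Real.sinh (2 * t))) :=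
    (tendsto_green_bracket_right h1 h2 hf ha hab hfb).add
      ((intervalIntegral_tendsto_integral_Ioi 0 hint tendsto_id).const_mul _)
  rw [tendsto_nhds_unique hconst hlim, zero_add]

/-! ### The eigenvalue form -/

omit [MeasurableSpace Circle] [BorelSpace Circle] in
include h1 h2 in
/-- `μ − μ′ = (λ − λ′)(λ + λ′ − 2) > 0` for `1 < λ′ < λ`. -/
theorem mu_sub_mu_pos : 0 < lam * (lam - 2) - lam' * (lam' - 2) := by
  have : lam * (lam - 2) - lam' * (lam' - 2) = (lam - lam') * (lam + lam' - 2) := by ring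
  rw [this]
  exact mul_pos (by linarith) (by linarith)

omit [BorelSpace Circle] in
include ha hab hfa hfb in
/-- The spherical transform of `f` is an integral over `[a, b]`. -/
theorem integral_Ioi_eq_intervalIntegral :
    ∫ t in Ioi 0, f t * sph lam' (hyp t) * Real.sinh (2 * t) = ∫ t in a..b, f t * sph lam' (hyp t) * Real.sinh (2 * t) := by
  rw [integral_of_le hab]
  refine setIntegral_eq_of_subset_of_forall_sdiff_eq_zero measurableSet_Ioi
    (fun t ht => lt_of_lt_of_le ha ht.1.le) ?_
  intro t ht
  rcases le_or_gt t a with h | h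
  · simp only [hfa t h, zero_mul]
  · have hbt : b < t := by
      by_contra hc
      exact ht.2 ⟨h, not_lt.mp hc⟩
    simp only [hfb t hbt.le, zero_mul]

include h1 h2 hf ha hab hfa hfb in
/-- **The resolvent acts on the spectral side as multiplication by `1/(μ′ − μ)`**:
`∫_0^∞ G_λ f · φ_{λ′} sinh 2t = (∫_0^∞ f φ_{λ′} sinh 2t) / (λ′(λ′ − 2) − λ(λ − 2))`. -/
theorem sphTransform_sphGreen :
    ∫ t in Ioi 0, sphGreen lam f a b t * sph lam' (hyp t) * Real.sinh (2 * t)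
      = (∫ t in Ioi 0, f t * sph lam' (hyp t) * Real.sinh (2 * t)) / (lam' * (lam' - 2) - lam * (lam - 2)) := by
  have hne : lam' * (lam' - 2) - lam * (lam - 2) ≠ 0 := ne_of_lt (by linarith [mu_sub_mu_pos h1 h2])
  rw [eq_div_iff hne, integral_Ioi_eq_intervalIntegral ha hab hfa hfb,
    ← resolvent_transform h1 h2 hf ha hab hfa hfb]
  ring

end measure

end Summit.Ventures.HodgeRepro2.T5SU11ResolventDiagonal
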